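import Mathlib
import HarnessLib
import Summits.ABC.ABC.Theses.NegOmegaAtlas
import Summits.ABC.ABC.Cruxes.NegThesis.StrategyCensus
import Summits.ABC.ABC.Theorems.NegOmegaAtlasAssembly
import Summits.ABC.ABC.Theorems.NegOmegaAtlasAtlasDichotomy
import Summits.ABC.ABC.Theorems.NegOmegaAtlasTwoSlotCell
import Literature.NumberTheory.DiophantineGeometry.AbcWave0QualityFormProofs
import Literature.NumberTheory.DiophantineGeometry.AbcWave0SUnitProofs

/-!
# STRATEGY CENSUS (Lean side) — crux `UnbalancedFamily` (stmt-ABC-1225), route `NegOmegaAtlas`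

Redirect-strategist workfile (seat `planner-cstrat-stmt-ABC-1225-r1-0`, 2026-08-17).  The crux is cell
(II-U) of the bounded-ω atlas:

`UnbalancedFamily := ∃ k, ∃ η > 0, ∃ δ > 0,
  {abc triples (a,b,c) | ω(abc) ≤ k ∧ min(a,b) ≤ c^(1-η) ∧ quality > 1+δ}.Infinite`.

The route is a REFUTATION route: `closes : NegThesis → UnbalancedFamily → … → Assembly → ¬ABC`
(term `h_Assembly h_NegThesis`; the binder `h_UnbalancedFamily` is not consumed).  Everything below is
sorry-free.  Sections:

* §0 vocabulary (`UViolators`, monotonicity);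
* §1 STRENGTH — the crux is the route's summit `¬ABC` in costume (strictly stronger):
  `negThesis_of_unbalancedFamily`, `not_abc_of_unbalancedFamily` (via the LANDED
  `negOmegaAtlasAssembly_proof`), `not_abc_of_unbalancedFamily'` (via the LANDED `atlasDichotomy_proof`),
  `not_unbalancedFamily_of_abc`;
* §2 NEGATION — `¬C ↔` uniform finiteness at every level; levels `k ≤ 2` settled from the landed
  `twoSlotCell_proof`; HARDNESS of level 3: `¬C` bounds the prime-base Pillai equation with gap 2
  (`primePillaiTwo_bounded_of_not_unbalancedFamily`), i.e. refuting the crux is at least Pillai-hard;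
* §3 STRENGTHEN — fixed support refuted (S-unit theorem, proved in the tree); the registered line
  `birth` is `¬ABC`-strength given its true transfer stub (`not_abc_of_gapStubs`); level structure;
* §4 DECOMPOSITION — the supply/upgrade bridge `C ↔ USupply ∧ (USupply → C)` and why its arrow is,
  under abc, exactly `¬USupply` (`abc_upgrade_iff_not_supply`).

Reuses `Summits.ABC.ABC.Cruxes.NegThesis.StrategyCensus` (sibling crux, seat cstrat-stmt-ABC-1224-s1):
`Violators`, `BoundedOmegaABC`, `boundedOmegaABC_two`, `finite_triples_le`.
-/

-- `Summit.<Summit>.<Problem>`: for the single-conjunct summit `ABC` the duplicate `ABC.ABC` is mandated.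
set_option linter.dupNamespace false

noncomputable section

namespace Summit.ABC.ABC.Cruxes.UnbalancedFamily.StrategyCensus

open Literature.NumberTheory.DiophantineGeometry
open Summit.ABC.ABC.Theses.NegOmegaAtlas
open Summit.ABC.ABC.Cruxes.NegThesis.StrategyCensus (Violators BoundedOmegaABC boundedOmegaABC_two
  finite_triples_le)

/-! ## §0 Vocabulary -/

/-- Cell (II-U) violators at level `k`, balance exponent `η`, margin `δ`: abc triples with `ω(abc) ≤ k`,
`min(a,b) ≤ c^(1-η)` and quality `> 1 + δ`. [folklore] -/
def UViolators (k : ℕ) (η δ : ℝ) : Set (ℕ × ℕ × ℕ) :=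
  {t | IsABCTriple t.1 t.2.1 t.2.2 ∧ (t.1 * t.2.1 * t.2.2).primeFactors.card ≤ k ∧
    ((min t.1 t.2.1 : ℕ) : ℝ) ≤ (t.2.2 : ℝ) ^ (1 - η) ∧ 1 + δ < quality t.1 t.2.1 t.2.2}

/-- The crux re-read through `UViolators` (definitional). [folklore] -/
theorem unbalancedFamily_iff :
    UnbalancedFamily ↔ ∃ k : ℕ, ∃ η : ℝ, 0 < η ∧ ∃ δ : ℝ, 0 < δ ∧ (UViolators k η δ).Infinite :=
  Iff.rfl

/-- Dropping the balance clause: cell-(II-U) violators are violators. [folklore] -/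
theorem uViolators_subset_violators (k : ℕ) (η δ : ℝ) : UViolators k η δ ⊆ Violators k δ :=
  fun _ ⟨ht, hk, _, hq⟩ => ⟨ht, hk, hq⟩

/-- Monotonicity of the cells: larger `k`, smaller `η`, smaller `δ` enlarge the violator set
(`c ≥ 1`, so `c^(1-η) ≤ c^(1-η')` for `η' ≤ η`). [folklore] -/
theorem uViolators_mono {k k' : ℕ} {η η' δ δ' : ℝ} (hk : k ≤ k') (hη : η' ≤ η) (hδ : δ' ≤ δ) :
    UViolators k η δ ⊆ UViolators k' η' δ' := by
  rintro ⟨a, b, c⟩ ⟨ht, hω, hmin, hq⟩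
  dsimp only at ht hω hmin hq ⊢
  refine ⟨ht, hω.trans hk, hmin.trans ?_, lt_of_le_of_lt (by linarith) hq⟩
  have h2c : 2 ≤ c := ht.two_le
  have hc1 : (1 : ℝ) ≤ (c : ℝ) := by exact_mod_cast (show 1 ≤ c by omega)
  exact Real.rpow_le_rpow_of_exponent_le hc1 (by linarith)

/-! ## §1 STRENGTH — the crux is at least the route's summit `¬ABC` -/

/-- `UnbalancedFamily → NegThesis`: drop the balance clause (`Set.Infinite.mono`). [folklore] -/
theorem negThesis_of_unbalancedFamily (h : UnbalancedFamily) : NegThesis := by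
  obtain ⟨k, η, -, δ, hδ, hinf⟩ := h
  exact ⟨k, δ, hδ, hinf.mono (uViolators_subset_violators k η δ)⟩

/-- **The crux is the route's summit in costume (strictly stronger).** `UnbalancedFamily → ¬ABC`, by
the LANDED assembly `negOmegaAtlasAssembly_proof : NegThesis → ¬ABC`
(`Theorems/NegOmegaAtlasAssembly.lean`). [folklore] -/
theorem not_abc_of_unbalancedFamily (h : UnbalancedFamily) : ¬ _root_.ABC :=
  Summit.ABC.ABC.Theorems.negOmegaAtlasAssembly_proof (negThesis_of_unbalancedFamily h)

/-- Same conclusion through the LANDED atlas dichotomy `atlasDichotomy_proof : NegThesis ↔ U ∨ B`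
(`Theorems/NegOmegaAtlasAtlasDichotomy.lean`): two landed theorems compose to `C → S`. [folklore] -/
theorem not_abc_of_unbalancedFamily' (h : UnbalancedFamily) : ¬ _root_.ABC :=
  Summit.ABC.ABC.Theorems.negOmegaAtlasAssembly_proof
    (Summit.ABC.ABC.Theorems.atlasDichotomy_proof.mpr (Or.inl h))

/-- Contrapositive: abc refutes the crux (the expected truth value of the item is FALSE). [folklore] -/
theorem not_unbalancedFamily_of_abc (habc : _root_.ABC) : ¬ UnbalancedFamily :=
  fun h => not_abc_of_unbalancedFamily h habc

/-! ## §2 NEGATION — refuting the crux = uniform unbalanced bounded-ω abc at every level -/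

/-- `¬UnbalancedFamily` is the uniform finiteness statement: at every level `(k, η, δ)` the cell has
only finitely many points ("uniform √-scale Pillai finiteness at bounded ω"). [folklore] -/
theorem not_unbalancedFamily_iff :
    ¬ UnbalancedFamily ↔ ∀ k : ℕ, ∀ η : ℝ, 0 < η → ∀ δ : ℝ, 0 < δ → (UViolators k η δ).Finite := by
  simp only [unbalancedFamily_iff, not_exists, not_and, Set.not_infinite]

/-- Bounded-ω abc at level `k` settles the cell at level `k`. [folklore] -/
theorem uFinite_of_boundedOmegaABC {k : ℕ} (h : BoundedOmegaABC k) (η δ : ℝ) (hδ : 0 < δ) :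
    (UViolators k η δ).Finite :=
  (h δ hδ).subset (uViolators_subset_violators k η δ)

/-- **Levels `k ≤ 2` are settled** (in the refuting direction) by the route's LANDED support item
`TwoSlotCell` (`twoSlotCell_proof`: `ω(abc) ≤ 2 ⟹ c < 2·rad`), through `boundedOmegaABC_two` of the
sibling census. [folklore] -/
theorem uFinite_of_le_two {k : ℕ} (hk : k ≤ 2) (η δ : ℝ) (hδ : 0 < δ) : (UViolators k η δ).Finite :=
  ((boundedOmegaABC_two Summit.ABC.ABC.Theorems.twoSlotCell_proof) δ hδ).subset
    fun _ ⟨ht, hω, _, hq⟩ => ⟨ht, hω.trans hk, hq⟩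

/-! ### Hardness of level 3: `¬C` bounds the prime-base Pillai equation with gap 2

The first open level `k = 3` of `¬UnbalancedFamily` contains the triples `(2, q^y, p^x)` coming from
the prime-base PILLAI EQUATION `p^x − q^y = 2` (`p, q` prime, `x, y ≥ 2`; iconic solution
`3³ − 5² = 2`): they are unbalanced (`min = 2 ≤ c^{1/2}`), have `ω = 3`, and quality `> 11/10` as soon as
`p^x ≥ 2^14`.  So refuting the crux — already at `(k, η, δ) = (3, 1/2, 1/10)` — bounds the solutions of
that equation, an open case of Pillai's conjecture (open for every gap `≥ 2`; cf. the in-tree hardness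
certificate `UniformSadicTowerFour.BoundedOmega.primePillaiTwo_bounded_of_boundedOmegaAt_three` for the
positive rung `B₃`, whose private size lemmas are re-proved here). -/

/-- In `q^y + 2 = p^x` with `p` prime and `x, y ≥ 2` the base `q` is not `2` (else `p = 2` and
`2^x = 2^y + 2` is absurd mod 4). Re-proof of the private in-tree lemma `pillaiTwo_two_ne`. [folklore] -/
theorem pillaiTwo_two_ne_q {p q x y : ℕ} (hp : p.Prime) (hx : 2 ≤ x) (hy : 2 ≤ y)
    (hE : q ^ y + 2 = p ^ x) : 2 ≠ q := by
  rintro rfl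
  have h2 : 2 ∣ p ^ x := by
    rw [← hE]
    exact dvd_add (dvd_pow_self 2 (by omega)) dvd_rfl
  obtain rfl : 2 = p := Nat.prime_eq_prime_of_dvd_pow Nat.prime_two hp h2
  obtain ⟨k, rfl⟩ := Nat.exists_eq_add_of_le' hx
  obtain ⟨l, rfl⟩ := Nat.exists_eq_add_of_le' hy
  rw [pow_add, pow_add] at hE
  omega

/-- … and `p ≠ 2` (`q` is odd, so `q^y + 2` is odd). [folklore] -/
theorem pillaiTwo_two_ne_p {p q x y : ℕ} (hp : p.Prime) (hq : q.Prime) (hx : 2 ≤ x) (hy : 2 ≤ y)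
    (hE : q ^ y + 2 = p ^ x) : 2 ≠ p := by
  have hqodd : Odd q := hq.odd_of_ne_two (pillaiTwo_two_ne_q hp hx hy hE).symm
  rintro rfl
  have h1 : Odd (q ^ y + 2) := hqodd.pow.add_even even_two
  rw [hE] at h1
  have h2 : Even (2 ^ x) := (Nat.even_pow' (by omega)).mpr even_two
  exact (Nat.not_even_iff_odd.mpr h1) h2

/-- … and `p ≠ q` (else `q ∣ 2`, so `q = 2`). [folklore] -/
theorem pillaiTwo_p_ne_q {p q x y : ℕ} (hp : p.Prime) (hx : 2 ≤ x) (hy : 2 ≤ y)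
    (hE : q ^ y + 2 = p ^ x) : p ≠ q := by
  rintro rfl
  have h1 : p ∣ p ^ x := dvd_pow_self p (by omega)
  have h2 : p ∣ p ^ y := dvd_pow_self p (by omega)
  have h3 : p ∣ 2 := by
    have : p ∣ p ^ y + 2 := hE ▸ h1
    exact (Nat.dvd_add_right h2).mp this
  have h4 : p ≤ 2 := Nat.le_of_dvd two_pos h3
  have h5 : 2 ≤ p := hp.two_le
  exact pillaiTwo_two_ne_q hp hx hy hE (by omega)

/-- Size bookkeeping (re-proof of the private in-tree `pillaiTwo_pow_six_le`): `x ≥ 3` or `y ≥ 3`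
(`p² − q² = 2` is insoluble), whence `(pq)^6 ≤ (p^x)^5`. [folklore] -/
theorem pillaiTwo_pow_six_le {p q x y : ℕ} (hp : p.Prime) (hq : q.Prime) (hx : 2 ≤ x)
    (hy : 2 ≤ y) (hE : q ^ y + 2 = p ^ x) : (p * q) ^ 6 ≤ (p ^ x) ^ 5 := by
  have hqc : q ^ y ≤ p ^ x := by omega
  rcases Nat.lt_or_ge 2 x with hx3 | hx2
  · calc (p * q) ^ 6 = p ^ 6 * q ^ 6 := mul_pow p q 6
    _ ≤ p ^ (x * 2) * q ^ (y * 3) :=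
        Nat.mul_le_mul (Nat.pow_le_pow_right hp.pos (by omega))
          (Nat.pow_le_pow_right hq.pos (by omega))
    _ = (p ^ x) ^ 2 * (q ^ y) ^ 3 := by rw [pow_mul, pow_mul]
    _ ≤ (p ^ x) ^ 2 * (p ^ x) ^ 3 := Nat.mul_le_mul le_rfl (Nat.pow_le_pow_left hqc 3)
    _ = (p ^ x) ^ 5 := by rw [← pow_add]
  rcases Nat.lt_or_ge 2 y with hy3 | hy2
  · calc (p * q) ^ 6 = p ^ 6 * q ^ 6 := mul_pow p q 6
    _ ≤ p ^ (x * 3) * q ^ (y * 2) :=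
        Nat.mul_le_mul (Nat.pow_le_pow_right hp.pos (by omega))
          (Nat.pow_le_pow_right hq.pos (by omega))
    _ = (p ^ x) ^ 3 * (q ^ y) ^ 2 := by rw [pow_mul, pow_mul]
    _ ≤ (p ^ x) ^ 3 * (p ^ x) ^ 2 := Nat.mul_le_mul le_rfl (Nat.pow_le_pow_left hqc 2)
    _ = (p ^ x) ^ 5 := by rw [← pow_add]
  · exfalso
    obtain rfl : x = 2 := le_antisymm hx2 hx
    obtain rfl : y = 2 := le_antisymm hy2 hy
    have h2q := hq.two_le
    rcases Nat.lt_or_ge q p with h | h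
    · nlinarith [Nat.pow_le_pow_left h 2]
    · nlinarith [Nat.pow_le_pow_left h 2]

/-- The radical inequality in `ℕ`: from `(pq)^6 ≤ c^5` and `c ≥ 2^14`,
`(2qp)^66 = 2^66·((pq)^6)^11 ≤ 2^66·c^55 < c^5·c^55 = c^60`. [folklore] -/
theorem pillaiTwo_rad_pow_lt {p q c : ℕ} (h6 : (p * q) ^ 6 ≤ c ^ 5) (hc : 2 ^ 14 ≤ c) :
    (2 * q * p) ^ 66 < c ^ 60 := by
  have hc0 : 0 < c := lt_of_lt_of_le (by norm_num) hc
  have h2 : ((p * q) ^ 6) ^ 11 ≤ (c ^ 5) ^ 11 := Nat.pow_le_pow_left h6 11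
  have h3 : 2 ^ 66 < c ^ 5 :=
    calc 2 ^ 66 < (2 ^ 14) ^ 5 := by norm_num
      _ ≤ c ^ 5 := Nat.pow_le_pow_left hc 5
  calc (2 * q * p) ^ 66 = 2 ^ 66 * ((p * q) ^ 6) ^ 11 := by ring
    _ ≤ 2 ^ 66 * (c ^ 5) ^ 11 := Nat.mul_le_mul_left _ h2
    _ < c ^ 5 * (c ^ 5) ^ 11 := Nat.mul_lt_mul_of_pos_right h3 (pow_pos (pow_pos hc0 5) 11)
    _ = c ^ 60 := by ring

/-- Prime factors of `2 · q^y · p^x`. [folklore] -/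
theorem pillaiTwo_primeFactors {p q x y : ℕ} (hp : p.Prime) (hq : q.Prime) (hx : x ≠ 0) (hy : y ≠ 0) :
    (2 * q ^ y * p ^ x).primeFactors = {2, q, p} := by
  rw [Nat.primeFactors_mul (mul_ne_zero two_ne_zero (pow_ne_zero _ hq.ne_zero)) (pow_ne_zero _ hp.ne_zero),
    Nat.primeFactors_mul two_ne_zero (pow_ne_zero _ hq.ne_zero),
    Nat.primeFactors_prime_pow hy hq, Nat.primeFactors_prime_pow hx hp,
    Nat.Prime.primeFactors Nat.prime_two]
  ext r
  simp

/-- Quality from an inequality of natural-number powers: `rad^u < c^v` with `v > 0` gives quality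
`> u / v` (for an abc triple `rad ≥ 2`, so `log rad > 0`). [folklore] -/
theorem div_lt_quality_of_pow_lt {a b c u v : ℕ} (ht : IsABCTriple a b c) (hv : 0 < v)
    (h : rad a b c ^ u < c ^ v) : (u : ℝ) / v < quality a b c := by
  have hr : (1 : ℝ) < (rad a b c : ℝ) := by exact_mod_cast ht.two_le_rad
  have hr0 : (0 : ℝ) < (rad a b c : ℝ) := zero_lt_one.trans hr
  have hlog : Real.log ((rad a b c : ℝ) ^ u) < Real.log ((c : ℝ) ^ v) :=
    Real.log_lt_log (pow_pos hr0 u) (by exact_mod_cast h)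
  rw [Real.log_pow, Real.log_pow] at hlog
  have hlr : 0 < Real.log (rad a b c : ℝ) := Real.log_pos hr
  have hv' : (0 : ℝ) < (v : ℝ) := by exact_mod_cast hv
  rw [quality, div_lt_div_iff₀ hv' hlr]
  linarith [mul_comm (v : ℝ) (Real.log (c : ℝ))]

/-- Unbalance from an inequality in `ℕ`: `m² ≤ c` gives `m ≤ c^(1 − 1/2)`. [folklore] -/
theorem cast_le_rpow_of_sq_le {m c : ℕ} (h : m ^ 2 ≤ c) : (m : ℝ) ≤ (c : ℝ) ^ (1 - (1 / 2 : ℝ)) := by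
  rw [show (1 : ℝ) - 1 / 2 = 1 / 2 by norm_num, ← Real.sqrt_eq_rpow]
  calc (m : ℝ) = √((m : ℝ) ^ 2) := (Real.sqrt_sq (Nat.cast_nonneg m)).symm
    _ ≤ √(c : ℝ) := Real.sqrt_le_sqrt (by exact_mod_cast h)

/-- **A large prime-base Pillai-gap-2 solution is a cell-(II-U) point at level `(3, 1/2, 1/10)`.**
[folklore] -/
theorem pillaiTwo_mem_uViolators {p q x y : ℕ} (hp : p.Prime) (hq : q.Prime) (hx : 2 ≤ x) (hy : 2 ≤ y)
    (hE : q ^ y + 2 = p ^ x) (hbig : 2 ^ 14 ≤ p ^ x) :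
    ((2, q ^ y, p ^ x) : ℕ × ℕ × ℕ) ∈ UViolators 3 (1 / 2) (1 / 10) := by
  have h2q := pillaiTwo_two_ne_q hp hx hy hE
  have h2p := pillaiTwo_two_ne_p hp hq hx hy hE
  have hpq := pillaiTwo_p_ne_q hp hx hy hE
  have hqodd : Odd q := hq.odd_of_ne_two h2q.symm
  have ht : IsABCTriple 2 (q ^ y) (p ^ x) :=
    ⟨two_pos, pow_pos hq.pos y, by omega, Nat.coprime_two_left.mpr hqodd.pow⟩
  have hpf := pillaiTwo_primeFactors hp hq (by omega : x ≠ 0) (by omega : y ≠ 0)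
  refine ⟨ht, ?_, ?_, ?_⟩
  · -- ω = card {2, q, p} ≤ 3
    show (2 * q ^ y * p ^ x).primeFactors.card ≤ 3
    rw [hpf]
    exact Finset.card_le_three
  · -- min(2, q^y) = 2 ≤ c^(1/2)
    show ((min 2 (q ^ y) : ℕ) : ℝ) ≤ ((p ^ x : ℕ) : ℝ) ^ (1 - (1 / 2 : ℝ))
    refine cast_le_rpow_of_sq_le ?_
    calc (min 2 (q ^ y)) ^ 2 ≤ 2 ^ 2 := Nat.pow_le_pow_left (min_le_left _ _) 2
      _ ≤ 2 ^ 14 := by norm_num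
      _ ≤ p ^ x := hbig
  · -- quality > 66/60 = 11/10 from rad^66 < c^60
    have hrad : rad 2 (q ^ y) (p ^ x) = 2 * q * p := by
      rw [rad_def, Nat.radical_eq_prod_primeFactors, hpf,
        Finset.prod_insert (by simp [h2q, h2p]), Finset.prod_insert (by simp [hpq.symm]),
        Finset.prod_singleton]
      ring
    have hlt : rad 2 (q ^ y) (p ^ x) ^ 66 < (p ^ x) ^ 60 := by
      rw [hrad]
      exact pillaiTwo_rad_pow_lt (pillaiTwo_pow_six_le hp hq hx hy hE) hbig
    have hq' := div_lt_quality_of_pow_lt ht (by norm_num) hlt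
    show (1 : ℝ) + 1 / 10 < quality 2 (q ^ y) (p ^ x)
    have : ((66 : ℕ) : ℝ) / ((60 : ℕ) : ℝ) = 1 + 1 / 10 := by norm_num
    linarith [this]

/-- **Prime-base Pillai with gap 2, unbounded** — the statement "the equation `p^x − q^y = 2` in primes
`p, q` and exponents `x, y ≥ 2` has solutions with `p^x` beyond every bound" (the negation of an open
case of Pillai's conjecture). [folklore] -/
def PrimePillaiTwoUnbounded : Prop :=
  ∀ N : ℕ, ∃ p q x y : ℕ, p.Prime ∧ q.Prime ∧ 2 ≤ x ∧ 2 ≤ y ∧ q ^ y + 2 = p ^ x ∧ N < p ^ x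

/-- An unbounded prime-base Pillai-gap-2 family inhabits cell (II-U) at level `(3, 1/2, 1/10)`, hence
proves the crux (a STRENGTHENING of the crux that is Pillai-false-in-spirit). [folklore] -/
theorem unbalancedFamily_of_primePillaiTwoUnbounded (h : PrimePillaiTwoUnbounded) : UnbalancedFamily := by
  refine ⟨3, 1 / 2, by norm_num, 1 / 10, by norm_num, ?_⟩
  intro hfin
  obtain ⟨N, hN⟩ := (hfin.image fun t : ℕ × ℕ × ℕ => t.2.2).bddAbove
  obtain ⟨p, q, x, y, hp, hq, hx, hy, hE, hlt⟩ := h (max N (2 ^ 14))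
  have hbig : 2 ^ 14 ≤ p ^ x := ((le_max_right _ _).trans hlt.le)
  have hmem := pillaiTwo_mem_uViolators hp hq hx hy hE hbig
  have hle : p ^ x ≤ N := mem_upperBounds.mp hN (p ^ x) ⟨(2, q ^ y, p ^ x), hmem, rfl⟩
  have : N < p ^ x := (le_max_left _ _).trans_lt hlt
  omega

/-- **HARDNESS CERTIFICATE (negation side).** Refuting the crux bounds the prime-base Pillai equation
with gap 2: `¬UnbalancedFamily ⟹ ∃ N, ∀ primes p q, ∀ x y ≥ 2, q^y + 2 = p^x → p^x ≤ N`.  Pillai's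
conjecture is open for every gap `≥ 2`; so the refutation of stmt-ABC-1225 is at least Pillai-hard
(already at level `k = 3`). [folklore] -/
theorem primePillaiTwo_bounded_of_not_unbalancedFamily (h : ¬ UnbalancedFamily) :
    ∃ N : ℕ, ∀ p q x y : ℕ, p.Prime → q.Prime → 2 ≤ x → 2 ≤ y → q ^ y + 2 = p ^ x → p ^ x ≤ N := by
  by_contra hN
  push Not at hN
  refine h (unbalancedFamily_of_primePillaiTwoUnbounded fun N => ?_)
  obtain ⟨p, q, x, y, hp, hq, hx, hy, hE, hlt⟩ := hN N
  exact ⟨p, q, x, y, hp, hq, hx, hy, hE, hlt⟩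

/-- In particular abc bounds the prime-base Pillai-gap-2 equation (through the crux). [folklore] -/
theorem primePillaiTwo_bounded_of_abc (habc : _root_.ABC) :
    ∃ N : ℕ, ∀ p q x y : ℕ, p.Prime → q.Prime → 2 ≤ x → 2 ≤ y → q ^ y + 2 = p ^ x → p ^ x ≤ N :=
  primePillaiTwo_bounded_of_not_unbalancedFamily (not_unbalancedFamily_of_abc habc)

/-- The iconic solution `5² + 2 = 3³` (abc triple `(2, 25, 27)`, quality `1.196`): the Pillai predicate
is inhabited in kind. [folklore] -/
example : ∃ p q x y : ℕ, p.Prime ∧ q.Prime ∧ 2 ≤ x ∧ 2 ≤ y ∧ q ^ y + 2 = p ^ x :=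
  ⟨3, 5, 3, 2, Nat.prime_three, by norm_num, by norm_num, le_rfl, by norm_num⟩

/-! ## §3 STRENGTHEN -/

/-- **S⁺₁ (fixed support, cell U).** Some finite set of primes carries infinitely many cell-(II-U)
violators. [folklore] -/
def UFixedSupportFamily : Prop :=
  ∃ S : Finset ℕ, ∃ η : ℝ, 0 < η ∧ ∃ δ : ℝ, 0 < δ ∧
    {t : ℕ × ℕ × ℕ | IsABCTriple t.1 t.2.1 t.2.2 ∧ (t.1 * t.2.1 * t.2.2).primeFactors ⊆ S ∧
      ((min t.1 t.2.1 : ℕ) : ℝ) ≤ (t.2.2 : ℝ) ^ (1 - η) ∧ 1 + δ < quality t.1 t.2.1 t.2.2}.Infinite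

/-- S⁺₁ is FALSE: the S-unit theorem over `ℚ` (abc.S25, PROVED in the tree,
`finite_setOf_isABCTriple_primeFactors_subset_holds`) leaves finitely many abc triples on any fixed
support — a cell-U family needs infinitely many distinct supports (moving primes). [cite: BombieriGubler2006, Thm. 5.2.1] -/
theorem not_uFixedSupportFamily : ¬ UFixedSupportFamily := by
  rintro ⟨S, η, -, δ, -, hinf⟩
  refine hinf ((finite_setOf_isABCTriple_primeFactors_subset_holds S).subset ?_)
  rintro t ⟨ht, hS, -, -⟩
  exact ⟨ht, hS⟩

/-- **S⁺₂ = the registered line `birth`** (`Cruxes/UnbalancedFamily/Lines/birth.lean`): quarter-scale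
prime-power gaps (`stub_primePowerGap`, OPEN) plus the TRUE transfer (`stub_gapTriple`) give the crux —
composition re-proved verbatim from the line file so that this census does not import a sorried module.
[folklore] -/
theorem unbalancedFamily_of_gapStubs
    (hA : ∃ ℓ : ℕ, ∀ N : ℕ, ∃ g q n p m : ℕ, N < p ^ m ∧ 0 < g ∧ g.primeFactors.card ≤ ℓ ∧ q.Prime ∧ p.Prime ∧
      Nat.Coprime g q ∧ 3 ≤ n ∧ 3 ≤ m ∧ g + q ^ n = p ^ m ∧ g ^ 4 ≤ p ^ m)
    (hB : ∀ g q n p m : ℕ, 0 < g → q.Prime → p.Prime → Nat.Coprime g q → 3 ≤ n → 3 ≤ m →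
      g + q ^ n = p ^ m → g ^ 4 ≤ p ^ m →
        IsABCTriple g (q ^ n) (p ^ m) ∧
        (g * q ^ n * p ^ m).primeFactors.card ≤ g.primeFactors.card + 2 ∧
        ((min g (q ^ n) : ℕ) : ℝ) ≤ ((p ^ m : ℕ) : ℝ) ^ (1 - (1 / 2 : ℝ)) ∧
        1 + (1 / 20 : ℝ) < quality g (q ^ n) (p ^ m)) :
    UnbalancedFamily := by
  obtain ⟨ℓ, hℓ⟩ := hA
  refine ⟨ℓ + 2, 1 / 2, by norm_num, 1 / 20, by norm_num, ?_⟩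
  intro hfin
  obtain ⟨N, hN⟩ := (hfin.image fun t : ℕ × ℕ × ℕ => t.2.2).bddAbove
  obtain ⟨g, q, n, p, m, hlt, hg, hω, hq, hp, hcop, hn, hm, hsum, hgap⟩ := hℓ N
  obtain ⟨h₁, h₂, h₃, h₄⟩ := hB g q n p m hg hq hp hcop hn hm hsum hgap
  have hmem : (g, q ^ n, p ^ m) ∈ UViolators (ℓ + 2) (1 / 2) (1 / 20) :=
    ⟨h₁, le_trans h₂ (by omega), h₃, h₄⟩
  have hle : p ^ m ≤ N := mem_upperBounds.mp hN (p ^ m) ⟨(g, q ^ n, p ^ m), hmem, rfl⟩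
  exact absurd (lt_of_lt_of_le hlt hle) (lt_irrefl N)

/-- **The line `birth` is `¬ABC`-strength one level down**: its open stub together with its TRUE stub
refutes abc — the sufficient configuration is a strict strengthening of the route's summit, exactly as
the crux is. [folklore] -/
theorem not_abc_of_gapStubs
    (hA : ∃ ℓ : ℕ, ∀ N : ℕ, ∃ g q n p m : ℕ, N < p ^ m ∧ 0 < g ∧ g.primeFactors.card ≤ ℓ ∧ q.Prime ∧ p.Prime ∧
      Nat.Coprime g q ∧ 3 ≤ n ∧ 3 ≤ m ∧ g + q ^ n = p ^ m ∧ g ^ 4 ≤ p ^ m)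
    (hB : ∀ g q n p m : ℕ, 0 < g → q.Prime → p.Prime → Nat.Coprime g q → 3 ≤ n → 3 ≤ m →
      g + q ^ n = p ^ m → g ^ 4 ≤ p ^ m →
        IsABCTriple g (q ^ n) (p ^ m) ∧
        (g * q ^ n * p ^ m).primeFactors.card ≤ g.primeFactors.card + 2 ∧
        ((min g (q ^ n) : ℕ) : ℝ) ≤ ((p ^ m : ℕ) : ℝ) ^ (1 - (1 / 2 : ℝ)) ∧
        1 + (1 / 20 : ℝ) < quality g (q ^ n) (p ^ m)) :
    ¬ _root_.ABC :=
  not_abc_of_unbalancedFamily (unbalancedFamily_of_gapStubs hA hB)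

/-- **S⁺₃ (induction on the level).** The cell at level `k`. [folklore] -/
def ULevel (k : ℕ) : Prop := ∃ η : ℝ, 0 < η ∧ ∃ δ : ℝ, 0 < δ ∧ (UViolators k η δ).Infinite

/-- The step `k → k+1` is free … [folklore] -/
theorem uLevel_mono {k k' : ℕ} (h : k ≤ k') : ULevel k → ULevel k' := by
  rintro ⟨η, hη, δ, hδ, hinf⟩
  exact ⟨η, hη, δ, hδ, hinf.mono (uViolators_mono h le_rfl le_rfl)⟩

/-- … the crux is `∃ k, ULevel k` … [folklore] -/
theorem unbalancedFamily_iff_exists_uLevel : UnbalancedFamily ↔ ∃ k, ULevel k := Iff.rfl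

/-- … the base `k ≤ 2` is refuted (TwoSlotCell) … [folklore] -/
theorem not_uLevel_of_le_two {k : ℕ} (hk : k ≤ 2) : ¬ ULevel k := by
  rintro ⟨η, -, δ, hδ, hinf⟩
  exact hinf (uFinite_of_le_two hk η δ hδ)

/-- … and the first open level `3` is implied by the (Pillai-false-in-spirit) prime-base Pillai-gap-2
family: the inductive structure carries no content of its own. [folklore] -/
theorem uLevel_three_of_primePillaiTwoUnbounded (h : PrimePillaiTwoUnbounded) : ULevel 3 := by
  obtain ⟨k, η, hη, δ, hδ, hinf⟩ := unbalancedFamily_of_primePillaiTwoUnbounded h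
  -- the proof above produced the level-3 cell literally; re-derive to keep the statement by name
  refine ⟨1 / 2, by norm_num, 1 / 10, by norm_num, ?_⟩
  intro hfin
  obtain ⟨N, hN⟩ := (hfin.image fun t : ℕ × ℕ × ℕ => t.2.2).bddAbove
  obtain ⟨p, q, x, y, hp, hq, hx, hy, hE, hlt⟩ := h (max N (2 ^ 14))
  have hmem := pillaiTwo_mem_uViolators hp hq hx hy hE ((le_max_right _ _).trans hlt.le)
  have hle : p ^ x ≤ N := mem_upperBounds.mp hN (p ^ x) ⟨(2, q ^ y, p ^ x), hmem, rfl⟩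
  have : N < p ^ x := (le_max_left _ _).trans_lt hlt
  omega

/-! ## §4 DECOMPOSITION — the supply / upgrade bridge -/

/-- Cell-(II-U) HITS at level `(k, η)`: unbalanced bounded-ω abc triples with `rad(abc) < c`
(quality `> 1`, no margin). [folklore] -/
def UHits (k : ℕ) (η : ℝ) : Set (ℕ × ℕ × ℕ) :=
  {t | IsABCTriple t.1 t.2.1 t.2.2 ∧ (t.1 * t.2.1 * t.2.2).primeFactors.card ≤ k ∧
    ((min t.1 t.2.1 : ℕ) : ℝ) ≤ (t.2.2 : ℝ) ^ (1 - η) ∧ rad t.1 t.2.1 t.2.2 < t.2.2}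

/-- SUPPLY: some cell `(k, η)` has infinitely many hits (abc-CONSISTENT; an almost-prime problem for
exponentially thin sequences). [folklore] -/
def USupply : Prop := ∃ k : ℕ, ∃ η : ℝ, 0 < η ∧ (UHits k η).Infinite

/-- UPGRADE (the arrow of the bridge): hits in some cell ⟹ margin-`δ` violators in some cell. [folklore] -/
def UUpgrade : Prop := USupply → UnbalancedFamily

/-- Violators are hits (`quality > 1 + δ ≥ 1 ⟹ rad < c`). [folklore] -/
theorem uViolators_subset_uHits {k : ℕ} {η δ : ℝ} (hδ : 0 ≤ δ) : UViolators k η δ ⊆ UHits k η := by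
  rintro ⟨a, b, c⟩ ⟨ht, hω, hmin, hq⟩
  refine ⟨ht, hω, hmin, ?_⟩
  have h1 : ((rad a b c : ℕ) : ℝ) ^ (1 + δ) < (c : ℝ) := (ht.one_add_lt_quality_iff δ).mp hq
  have hr1 : (1 : ℝ) ≤ (rad a b c : ℝ) := by exact_mod_cast (le_trans one_le_two ht.two_le_rad)
  have h2 : ((rad a b c : ℕ) : ℝ) ≤ ((rad a b c : ℕ) : ℝ) ^ (1 + δ) := by
    calc ((rad a b c : ℕ) : ℝ) = ((rad a b c : ℕ) : ℝ) ^ (1 : ℝ) := (Real.rpow_one _).symm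
      _ ≤ ((rad a b c : ℕ) : ℝ) ^ (1 + δ) := Real.rpow_le_rpow_of_exponent_le hr1 (by linarith)
  exact_mod_cast h2.trans_lt h1

/-- The crux supplies its own hits. [folklore] -/
theorem uSupply_of_unbalancedFamily (h : UnbalancedFamily) : USupply := by
  obtain ⟨k, η, hη, δ, hδ, hinf⟩ := h
  exact ⟨k, η, hη, hinf.mono (uViolators_subset_uHits hδ.le)⟩

/-- **The bridge split, exact**: `C ↔ USupply ∧ (USupply → C)`. [folklore] -/
theorem unbalancedFamily_iff_supply_upgrade : UnbalancedFamily ↔ USupply ∧ UUpgrade :=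
  ⟨fun h => ⟨uSupply_of_unbalancedFamily h, fun _ => h⟩, fun ⟨h₁, h₂⟩ => h₂ h₁⟩

/-- The arrow has exactly two kinds of proof: refute the supply … [folklore] -/
theorem uUpgrade_of_not_supply (h : ¬ USupply) : UUpgrade := fun hs => absurd hs h

/-- … or prove the crux. [folklore] -/
theorem uUpgrade_of_unbalancedFamily (h : UnbalancedFamily) : UUpgrade := fun _ => h

/-- **Under abc the arrow IS the refutation of the supply** (`ABC → (UUpgrade ↔ ¬USupply)`): the bridge
moves no content — its hard half is either `¬ABC`-strength (prove `C`) or the uniform finiteness of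
unbalanced bounded-ω HITS, an ε-free abc-type statement predicted FALSE for large `k` by the supply
heuristic (polylog many hits per scale). [folklore] -/
theorem abc_upgrade_iff_not_supply (habc : _root_.ABC) : UUpgrade ↔ ¬ USupply :=
  ⟨fun hu hs => not_unbalancedFamily_of_abc habc (hu hs), uUpgrade_of_not_supply⟩

/-- The supply predicate is inhabited in kind: `(1, 8, 9)` is a cell-U hit at level `(2, 1/2)`
(`rad = 6 < 9`, `min = 1 ≤ 3`). [folklore] -/
example : ((1, 8, 9) : ℕ × ℕ × ℕ) ∈ UHits 2 (1 / 2) := by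
  have hpf : (1 * 8 * 9).primeFactors = {2, 3} := by
    rw [show (1 * 8 * 9 : ℕ) = 2 ^ 3 * 3 ^ 2 by norm_num,
      Nat.primeFactors_mul (by norm_num) (by norm_num),
      Nat.primeFactors_prime_pow (by norm_num) Nat.prime_two,
      Nat.primeFactors_prime_pow (by norm_num) Nat.prime_three]
    decide
  have hrad : rad 1 8 9 = 6 := by
    rw [rad_def, Nat.radical_eq_prod_primeFactors, hpf]; decide
  refine ⟨⟨by norm_num, by norm_num, by norm_num, by norm_num⟩, ?_, ?_, ?_⟩
  · simp only; rw [hpf]; decide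
  · show ((min 1 8 : ℕ) : ℝ) ≤ ((9 : ℕ) : ℝ) ^ (1 - (1 / 2 : ℝ))
    exact cast_le_rpow_of_sq_le (by norm_num)
  · show rad 1 8 9 < 9
    rw [hrad]; norm_num

end Summit.ABC.ABC.Cruxes.UnbalancedFamily.StrategyCensus

end
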